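import Summits.QuantumFields.YangMills.Theorems.BalabanUVNodesN18StationaryKernelOfKernelLettersCorner
import Summits.QuantumFields.YangMills.Theorems.BalabanUVNodesN18ThreeKernelLettersAndBase
import Summits.QuantumFields.YangMills.Theorems.BalabanUVNodesN22AtU3OfKernels
import Summits.QuantumFields.YangMills.Theorems.BalabanUVNodesD4KernelDecayOfWindowed
import Summits.QuantumFields.YangMills.Theorems.BalabanUVNodesN18AtRecordOfKernelLetters

/-!
# BalabanUVNodes ∕ N18 — THE STATIONARY KERNEL OF RECORD, FILE 3: READ OFF K3⁷ v5's BILL ROWS (guarded θ-form, `N`-generic, regime-generic) — per guarded admissible tuple the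
# bill's displayed kernel-letter rows `hs hκ hL h9 hS hW` (dag-n27-w1's `K3V5Defs.keyedRatesHolderD4_rrOfRecord_of_pins_of_letters`), or dag-n18-w4's THREE LETTERS + LEVEL-0 ROW
# `hs hκ hL h9 hS h0` (`…N18ThreeKernelLettersAndBase`, `hW` a consequence), DELIVER FILE 2's stationary kernel of record with its tail, (5.10) class, memory profile and
# (1.22) AT LEVEL ∞ for `betaOfRecord₁₃ F N θ`, and the UV-corner commutation — so node U2's continuum functional of the β of record is available BY NAME wherever stub 1's rows are
# (Track A, DAG node N18 = NE5; cluster K4 «SpineRates»; key K3⁷ `SpineGivenEndpointR13SepCoPH` = stmt-QuantumFields-20544, skeleton v5 941dddb108cbaacf; width seat `pub-ymgap-dag-n18-w1` g5,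
# FILE 3 of the g5 series — FILE 1 `…N18StationaryKernelOfKernelLetters` p620457, FILE 2 `…N18StationaryKernelOfKernelLettersCorner`)

HONEST FRAMING.  Count-neutral kernel bookkeeping BY NAME (`--kind proof --supports stmt-QuantumFields-20544 --as helper`): COMPOSITIONS of FILE 2's record theorems with the landed
windowed ⟹ limit passages — dag-n22-w3's `n22At_u3OfRecord₁₃_objectsOfRecord₁₃_of_windowed` ∕ `…_iff` (kernel NE9 of record from `PolLimitsExistOfRecord₁₃` + `WindowedNE9OfRecord₁₃`) and
`kernelDecayOfRecord₁₃_of_windowed` ((5.10) clause of record from `PolLimitsExistOfRecord₁₃` + `WindowedDecayOfRecord₁₃`), this seat's g2 `kernelStepRateOfRecord₁₃_of_windowed'` (N18's letter of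
record from `PolLimitsExistOfRecord₁₃` + `WindowedStepRateOfRecord₁₃` at run offset `s F θ`), dag-n18-w4's `windowedDecayOfRecord₁₃_guarded_of_stepRate_of_base` (`hW` from `hs hS` + the
level-0 row).  EVERY ROW IS A DISPLAYED HYPOTHESIS inhabited for no family today (K0⁷ OPEN): the windowed two-run step rate and windowed NE9 are finite-volume statements of Bałaban-type
SHAPE NOT PRINTED for d = 4, (1.21)'s existence is [I] p. 264 «this limit exists by (1.7)» (NOT proved in the tree), the windowed (5.10) bounds ∕ the level-0 row are [I] (5.10) p. 293 read
before the limit; nothing of Bałaban's asserted or instantiated; NO value ∕ sign of the stationary kernel, of the corner number or of `betaInf` claimed; N17 ∕ N18 ∕ N22 ∕ (D4) NOT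
discharged; NOT a proof of `stub_rates13H` ∕ `stub_expansion13H`; K3⁷ OPEN; skeleton v5 UNTOUCHED.  Counts UNMOVED (typed 28∕28 · discharged 5∕27, A 5∕28).  One finite four-torus programme
at fixed `ε`, Bałaban AS PRINTED; route R4 closes ONLY the conditional finite-𝕋⁴ rung `BalabanLadder.UV` — NOT the continuum limit, NOT ℝ⁴, NOT OS, NOT the Yang–Mills mass gap, NOT Clay.
THEOREMS ONLY: 0 `def`, 0 `instance`, 0 `sorry`, standard axioms.

WHAT (theorems only; `Rg` a regime predicate, `ℓ F θ` the letter-block reading, `s F θ` the run-offset reading, `E₀ F θ` the level-0 constant reading).  §7 the three LIMIT letters of record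
from the rows: `kernelNE9OfRecord_guarded_of_rows` (`hs hL h9` ⟹ kernel NE9 of `(objectsOfRecord₁₃ …).EA 0`) · `kernelStepRateOfRecord₁₃_guarded_of_rows` (`hL hS` ⟹ `KernelStepRateOfRecord₁₃`)
(the third, the (5.10) clause of record `hL hW ⟹ KernelDecayOfRecord₁₃ … 0 1 κ`, is dag-n27-w1's (Kᴸ) `BalabanUVNodesN27SpineRecord.kernelDecayOfRecord₁₃_of_letters_guarded` — cited, NOT
re-declared; inside the proofs dag-n22-w3's `kernelDecayOfRecord₁₃_of_windowed` is applied directly).  §8 ★★ `stationaryKernel_record_guarded_of_rows` (the bill's rows `hs hκ hL h9 hS hW` ⟹ per guarded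
tuple FILE 2's `stationaryKernel_record_of_kernelLetters` package) · ★★ `stationaryKernel_record_guarded_of_threeLetters_of_base` (dag-n18-w4's rows `hs hκ hL h9 hS h0`) · ★
`tendsto_betaInf_betaOfRecord₁₃_const_guarded_of_rows` (per guarded tuple with `0 < θ.γ`: the UV-corner commutation for the β of record from the bill's rows).

References (TYPES ∕ locators only): [Balaban1987RG1] CMP **109** (1987): p. 255 (one β-function: motivation only), Thm 1 p. 259 (NE5 NOT printed), (1.18) p. 263, (1.20)–(1.22)
p. 264, §5 p. 298, (5.10) p. 293.
-/

noncomputable section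

open Filter Topology
open scoped BigOperators

namespace YMDAG.N18.StationaryKernelOfKernelLetters

open scoped Matrix.Norms.L2Operator
open Literature.MathematicalPhysics.QuantumFieldTheory.Balaban1983to89
open Literature.MathematicalPhysics.QuantumFieldTheory.Balaban1983to89.T4Continuum (T4Family)
open Literature.MathematicalPhysics.QuantumFieldTheory.Balaban1983to89.T4OutputRate (Window NE9)
open Literature.MathematicalPhysics.QuantumFieldTheory.Balaban1983to89.B12Beta (secondMoment)
open Literature.MathematicalPhysics.QuantumFieldTheory.Balaban1983to89.T4FlagMemory (extd)
open Literature.MathematicalPhysics.QuantumFieldTheory.Balaban1983to89.T4BetaStationary (SeqBox revHist betaInf)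
open Literature.MathematicalPhysics.QuantumFieldTheory.Balaban1983to89.Node00 (mergedTermFamilyMatT TβOfRecord₁₃ chiβOfRecord₁₃ betaOfRecord₁₃ Stage13HParams U3Letters₁₁
  polWindow)
open Literature.MathematicalPhysics.QuantumFieldTheory.Balaban1983to89.Node00.U3OfKernels (kernelA objectsOfRecord₁₃ KernelDecayOfRecord₁₃ histPrefix)
open Literature.MathematicalPhysics.QuantumFieldTheory.Balaban1983to89.Node00.U3KernelLetters (PolLimitsExistOfRecord₁₃ WindowedNE9OfRecord₁₃ WindowedDecayOfRecord₁₃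
  WindowedStepRateOfRecord₁₃ KernelStepRateOfRecord₁₃)
open Literature.MathematicalPhysics.QuantumFieldTheory.Balaban1983to89.B12Sec2to5 (l1 Decay510)
open YMDAG.N22.AtKernels (n22At_u3OfRecord₁₃_objectsOfRecord₁₃_of_windowed n22At_u3OfRecord₁₃_objectsOfRecord₁₃_iff kernelDecayOfRecord₁₃_of_windowed)
open YMDAG.N18.AtRecordOfKernelLetters (kernelStepRateOfRecord₁₃_of_windowed')
open YMDAG.N18.ThreeKernelLettersAndBase (windowedDecayOfRecord₁₃_guarded_of_stepRate_of_base)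

variable {N : ℕ} [NeZero N] (Rg : (F : T4Family) → Stage13HParams F N → Prop) (ℓ : (F : T4Family) → Stage13HParams F N → U3Letters₁₁)
  (s : (F : T4Family) → Stage13HParams F N → ℕ) (E₀ : (F : T4Family) → Stage13HParams F N → ℝ)

/-! ## §7 The three LIMIT letters of record from the bill's windowed rows (guarded θ-form; by name) -/

/-- **KERNEL NE9 OF RECORD FROM THE ROWS** (`hs hL h9`; dag-n22-w3's (1.21) passage + its `Iff` to W1-19's kernel currency): per guarded tuple `NE9 ((objectsOfRecord₁₃ F N θ ℓ).EA 0) (Window θ.γ)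
κ Λ` at `(κ, Λ) = ((ℓ F θ).κ, (ℓ F θ).moduli)` — FILE 2 §6's `h9`.  LOCATED; N22 NOT discharged. [cite: Balaban1987RG1, (1.18) p.263, (1.20)-(1.21) p.264 and §5 p.298] -/
theorem kernelNE9OfRecord_guarded_of_rows
    (hs : ∀ (F : T4Family) (θ : Stage13HParams F N), θ.Provisos₁₃CoPH F N → Rg F θ → θ.Admissible F N → (ℓ F θ).Signs)
    (hL : ∀ (F : T4Family) (θ : Stage13HParams F N), θ.Provisos₁₃CoPH F N → Rg F θ → θ.Admissible F N → PolLimitsExistOfRecord₁₃ F N θ.toStage13Params)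
    (h9 : ∀ (F : T4Family) (θ : Stage13HParams F N), θ.Provisos₁₃CoPH F N → Rg F θ → θ.Admissible F N →
      WindowedNE9OfRecord₁₃ F N θ.toStage13Params (ℓ F θ).κ (ℓ F θ).moduli) :
    ∀ (F : T4Family) (θ : Stage13HParams F N), θ.Provisos₁₃CoPH F N → Rg F θ → θ.Admissible F N →
      NE9 ((objectsOfRecord₁₃ F N θ.toStage13Params (ℓ F θ)).EA 0) (Window θ.toStage13Params.γ) (ℓ F θ).κ (ℓ F θ).moduli :=
  fun F θ hP hRg hθ =>
    (n22At_u3OfRecord₁₃_objectsOfRecord₁₃_iff F N θ.toStage13Params (ℓ F θ) (hs F θ hP hRg hθ) 0).1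
      (n22At_u3OfRecord₁₃_objectsOfRecord₁₃_of_windowed F N θ.toStage13Params (ℓ F θ) (hs F θ hP hRg hθ) 0 (hL F θ hP hRg hθ) (h9 F θ hP hRg hθ))

/-- **N18's LETTER OF RECORD FROM THE ROWS** (`hL hS`; this seat's g2 finite-volume reduction `kernelStepRateOfRecord₁₃_of_windowed'` at run offset `s F θ`): per guarded tuple
`KernelStepRateOfRecord₁₃ F N θ κ θ₅ C₅`.  LOCATED; N18 NOT discharged. [cite: Balaban1987RG1, Thm 1 p.259 and (1.20)-(1.21) p.264] -/
theorem kernelStepRateOfRecord₁₃_guarded_of_rows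
    (hL : ∀ (F : T4Family) (θ : Stage13HParams F N), θ.Provisos₁₃CoPH F N → Rg F θ → θ.Admissible F N → PolLimitsExistOfRecord₁₃ F N θ.toStage13Params)
    (hS : ∀ (F : T4Family) (θ : Stage13HParams F N), θ.Provisos₁₃CoPH F N → Rg F θ → θ.Admissible F N →
      WindowedStepRateOfRecord₁₃ F N θ.toStage13Params (s F θ) (ℓ F θ).κ (ℓ F θ).θ₅ ((ℓ F θ).C₅ * (ℓ F θ).θ₅)) :
    ∀ (F : T4Family) (θ : Stage13HParams F N), θ.Provisos₁₃CoPH F N → Rg F θ → θ.Admissible F N →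
      KernelStepRateOfRecord₁₃ F N θ.toStage13Params (ℓ F θ).κ (ℓ F θ).θ₅ (ℓ F θ).C₅ :=
  fun F θ hP hRg hθ => kernelStepRateOfRecord₁₃_of_windowed' F N θ.toStage13Params (s F θ) (hL F θ hP hRg hθ) (hS F θ hP hRg hθ)

/-! ## §8 The stationary kernel of record and its faces, per guarded tuple, from the rows -/

/-- ★★ **THE STATIONARY KERNEL OF RECORD FROM K3⁷ v5's BILL ROWS** (`hs hκ hL h9 hS hW` — EXACTLY the kernel-letter rows of dag-n27-w1's `keyedRatesHolderD4_rrOfRecord_of_pins_of_letters`, same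
binder shapes): per guarded admissible tuple there is ONE kernel functional `Π_∞` of the box-valued reversed history with — for every `h ∈ ]0,θ.γ]^ℕ` — convergence of the merged (1.21) kernels of
record along `revHist h k`, the tail `ℓ.C₅ℓ.θ₅^{k+1}e^{−ℓ.κ|z|₁}∕(1−ℓ.θ₅)`, the (5.10) class at `ℓ.κ`, the memory profile `e^{−ℓ.κ|z|₁}ℓ.C₉ℓ.ω·Σ'ℓ.ω^j|h j − h′ j|`, and (1.22) AT LEVEL ∞ for the β of
record: `betaOfRecord₁₃ F N θ k (revHist h k) → secondMoment (Π_∞ h) 0 1 = betaInf (betaOfRecord₁₃ F N θ) h` (FILE 2's `stationaryKernel_record_of_kernelLetters` ∘ §7).  Every row a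
HYPOTHESIS; nothing of Bałaban asserted; NOT a proof of the stubs. [cite: Balaban1987RG1, Thm 1 p.259, (1.20)-(1.22) p.264, §5 p.298 and (5.10) p.293] -/
theorem stationaryKernel_record_guarded_of_rows
    (hs : ∀ (F : T4Family) (θ : Stage13HParams F N), θ.Provisos₁₃CoPH F N → Rg F θ → θ.Admissible F N → (ℓ F θ).Signs)
    (hκ : ∀ (F : T4Family) (θ : Stage13HParams F N), θ.Provisos₁₃CoPH F N → Rg F θ → θ.Admissible F N → 0 < (ℓ F θ).κ)
    (hL : ∀ (F : T4Family) (θ : Stage13HParams F N), θ.Provisos₁₃CoPH F N → Rg F θ → θ.Admissible F N → PolLimitsExistOfRecord₁₃ F N θ.toStage13Params)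
    (h9 : ∀ (F : T4Family) (θ : Stage13HParams F N), θ.Provisos₁₃CoPH F N → Rg F θ → θ.Admissible F N →
      WindowedNE9OfRecord₁₃ F N θ.toStage13Params (ℓ F θ).κ (ℓ F θ).moduli)
    (hS : ∀ (F : T4Family) (θ : Stage13HParams F N), θ.Provisos₁₃CoPH F N → Rg F θ → θ.Admissible F N →
      WindowedStepRateOfRecord₁₃ F N θ.toStage13Params (s F θ) (ℓ F θ).κ (ℓ F θ).θ₅ ((ℓ F θ).C₅ * (ℓ F θ).θ₅))
    (hW : ∀ (F : T4Family) (θ : Stage13HParams F N), θ.Provisos₁₃CoPH F N → Rg F θ → θ.Admissible F N →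
      WindowedDecayOfRecord₁₃ F N θ.toStage13Params 0 1 (ℓ F θ).κ) :
    ∀ (F : T4Family) (θ : Stage13HParams F N), θ.Provisos₁₃CoPH F N → Rg F θ → θ.Admissible F N →
      letI := θ.toStage13Params.instVβ₁; letI := θ.toStage13Params.instVβ₂; letI := θ.toStage13Params.instιβ
      ∃ Pst : (ℕ → ℝ) → B12Beta.Kernel 4, ∀ h : ℕ → ℝ, SeqBox θ.toStage13Params.γ h →
        (∀ (μ ν : Fin 4) (z : Fin 4 → ℤ),
          Tendsto (fun k : ℕ => kernelA F (mergedTermFamilyMatT F N (TβOfRecord₁₃ F N) (chiβOfRecord₁₃ F N θ.toStage13Params) θ.toStage13Params.εbg)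
            θ.toStage13Params.ρ8 θ.toStage13Params.bV (extd (revHist h k)) k μ ν z) atTop (𝓝 (Pst h μ ν z))) ∧
        (∀ (μ ν : Fin 4) (z : Fin 4 → ℤ) (k : ℕ),
          |kernelA F (mergedTermFamilyMatT F N (TβOfRecord₁₃ F N) (chiβOfRecord₁₃ F N θ.toStage13Params) θ.toStage13Params.εbg)
              θ.toStage13Params.ρ8 θ.toStage13Params.bV (extd (revHist h k)) k μ ν z - Pst h μ ν z| ≤
            (ℓ F θ).C₅ * (ℓ F θ).θ₅ ^ (k + 1) * Real.exp (-((ℓ F θ).κ * l1 z)) / (1 - (ℓ F θ).θ₅)) ∧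
        (∃ C : ℝ, Decay510 (Pst h 0 1) C (ℓ F θ).κ) ∧
        (∀ h' : ℕ → ℝ, SeqBox θ.toStage13Params.γ h' → ∀ (μ ν : Fin 4) (z : Fin 4 → ℤ),
          |Pst h μ ν z - Pst h' μ ν z| ≤ (Real.exp (-((ℓ F θ).κ * l1 z)) * (ℓ F θ).C₉ * (ℓ F θ).ω) * ∑' j, (ℓ F θ).ω ^ j * |h j - h' j|) ∧
        Tendsto (fun k : ℕ => betaOfRecord₁₃ F N θ.toStage13Params k (revHist h k)) atTop (𝓝 (secondMoment (Pst h) 0 1)) ∧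
        betaInf (betaOfRecord₁₃ F N θ.toStage13Params) h = secondMoment (Pst h) 0 1 :=
  fun F θ hP hRg hθ =>
    stationaryKernel_record_of_kernelLetters F N θ.toStage13Params (ℓ F θ) (hs F θ hP hRg hθ) (hκ F θ hP hRg hθ)
      (kernelNE9OfRecord_guarded_of_rows Rg ℓ hs hL h9 F θ hP hRg hθ)
      (kernelDecayOfRecord₁₃_of_windowed F N θ.toStage13Params 0 1 (ℓ F θ).κ (hL F θ hP hRg hθ) (hW F θ hP hRg hθ))
      (kernelStepRateOfRecord₁₃_guarded_of_rows Rg ℓ s hL hS F θ hP hRg hθ)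

/-- ★★ **THE SAME FROM dag-n18-w4's THREE KERNEL LETTERS + LEVEL-0 ROW** (`hs hκ hL h9 hS h0`): the (D4) windowed-decay row `hW` is a CONSEQUENCE of `hs hS` and the level-0 row (`…N18ThreeKernelLettersAndBase`
`windowedDecayOfRecord₁₃_guarded_of_stepRate_of_base`), so stub 1's displayed kernel inputs — three letters + level 0 — already carry node U2's continuum functional of the β of record with its
kernel representation.  Every row a HYPOTHESIS; nothing of Bałaban asserted. [cite: Balaban1987RG1, Thm 1 p.259, (1.20)-(1.22) p.264, §5 p.298 and (5.10) p.293] -/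
theorem stationaryKernel_record_guarded_of_threeLetters_of_base
    (hs : ∀ (F : T4Family) (θ : Stage13HParams F N), θ.Provisos₁₃CoPH F N → Rg F θ → θ.Admissible F N → (ℓ F θ).Signs)
    (hκ : ∀ (F : T4Family) (θ : Stage13HParams F N), θ.Provisos₁₃CoPH F N → Rg F θ → θ.Admissible F N → 0 < (ℓ F θ).κ)
    (hL : ∀ (F : T4Family) (θ : Stage13HParams F N), θ.Provisos₁₃CoPH F N → Rg F θ → θ.Admissible F N → PolLimitsExistOfRecord₁₃ F N θ.toStage13Params)
    (h9 : ∀ (F : T4Family) (θ : Stage13HParams F N), θ.Provisos₁₃CoPH F N → Rg F θ → θ.Admissible F N →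
      WindowedNE9OfRecord₁₃ F N θ.toStage13Params (ℓ F θ).κ (ℓ F θ).moduli)
    (hS : ∀ (F : T4Family) (θ : Stage13HParams F N), θ.Provisos₁₃CoPH F N → Rg F θ → θ.Admissible F N →
      WindowedStepRateOfRecord₁₃ F N θ.toStage13Params (s F θ) (ℓ F θ).κ (ℓ F θ).θ₅ ((ℓ F θ).C₅ * (ℓ F θ).θ₅))
    (h0 : ∀ (F : T4Family) (θ : Stage13HParams F N), θ.Provisos₁₃CoPH F N → Rg F θ → θ.Admissible F N →
      letI := θ.toStage13Params.instVβ₁; letI := θ.toStage13Params.instVβ₂; letI := θ.toStage13Params.instιβ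
      ∀ g ∈ Window θ.toStage13Params.γ, ∀ (μ ν : Fin 4) (z : Fin 4 → ℤ), ∀ᶠ K in atTop,
        |polWindow F K 1 (mergedTermFamilyMatT F N (TβOfRecord₁₃ F N) (chiβOfRecord₁₃ F N θ.toStage13Params) θ.toStage13Params.εbg 0 (histPrefix g 0) K)
            θ.toStage13Params.ρ8 θ.toStage13Params.bV μ ν z| ≤ E₀ F θ * Real.exp (-(ℓ F θ).κ * l1 z)) :
    ∀ (F : T4Family) (θ : Stage13HParams F N), θ.Provisos₁₃CoPH F N → Rg F θ → θ.Admissible F N →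
      letI := θ.toStage13Params.instVβ₁; letI := θ.toStage13Params.instVβ₂; letI := θ.toStage13Params.instιβ
      ∃ Pst : (ℕ → ℝ) → B12Beta.Kernel 4, ∀ h : ℕ → ℝ, SeqBox θ.toStage13Params.γ h →
        (∀ (μ ν : Fin 4) (z : Fin 4 → ℤ),
          Tendsto (fun k : ℕ => kernelA F (mergedTermFamilyMatT F N (TβOfRecord₁₃ F N) (chiβOfRecord₁₃ F N θ.toStage13Params) θ.toStage13Params.εbg)
            θ.toStage13Params.ρ8 θ.toStage13Params.bV (extd (revHist h k)) k μ ν z) atTop (𝓝 (Pst h μ ν z))) ∧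
        (∀ (μ ν : Fin 4) (z : Fin 4 → ℤ) (k : ℕ),
          |kernelA F (mergedTermFamilyMatT F N (TβOfRecord₁₃ F N) (chiβOfRecord₁₃ F N θ.toStage13Params) θ.toStage13Params.εbg)
              θ.toStage13Params.ρ8 θ.toStage13Params.bV (extd (revHist h k)) k μ ν z - Pst h μ ν z| ≤
            (ℓ F θ).C₅ * (ℓ F θ).θ₅ ^ (k + 1) * Real.exp (-((ℓ F θ).κ * l1 z)) / (1 - (ℓ F θ).θ₅)) ∧
        (∃ C : ℝ, Decay510 (Pst h 0 1) C (ℓ F θ).κ) ∧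
        (∀ h' : ℕ → ℝ, SeqBox θ.toStage13Params.γ h' → ∀ (μ ν : Fin 4) (z : Fin 4 → ℤ),
          |Pst h μ ν z - Pst h' μ ν z| ≤ (Real.exp (-((ℓ F θ).κ * l1 z)) * (ℓ F θ).C₉ * (ℓ F θ).ω) * ∑' j, (ℓ F θ).ω ^ j * |h j - h' j|) ∧
        Tendsto (fun k : ℕ => betaOfRecord₁₃ F N θ.toStage13Params k (revHist h k)) atTop (𝓝 (secondMoment (Pst h) 0 1)) ∧
        betaInf (betaOfRecord₁₃ F N θ.toStage13Params) h = secondMoment (Pst h) 0 1 :=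
  stationaryKernel_record_guarded_of_rows Rg ℓ s hs hκ hL h9 hS
    (fun F θ hP hRg hθ => windowedDecayOfRecord₁₃_guarded_of_stepRate_of_base Rg ℓ s E₀ hs hS h0 F θ hP hRg hθ 0 1)

/-- ★ **THE UV-CORNER COMMUTATION FOR THE β OF RECORD FROM THE BILL ROWS** (+ `0 < θ.γ` per tuple): if `betaOfRecord₁₃ F N θ k (t,…,t) → c_k` as `t → 0⁺` and `c_k → c_∞` (g4 FILE 3's
`cornerNumbers_record_geometric_of_kernelLetters` produces such a pair from the same letters), then `betaInf (betaOfRecord₁₃ F N θ) (t,t,…) → c_∞` as `t → 0⁺` — the corner limit number of the β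
of record IS the UV corner value of node U2's continuum functional of the β of record, read off stub 1's displayed rows.  Its VALUE ∕ SIGN is NOT claimed (K2's one bit untouched); nothing of
Bałaban asserted. [cite: Balaban1987RG1, (1.22) p.264, (2.12)-(2.14) p.268, (5.10) p.293 and p.255 (motivation)] -/
theorem tendsto_betaInf_betaOfRecord₁₃_const_guarded_of_rows
    (hs : ∀ (F : T4Family) (θ : Stage13HParams F N), θ.Provisos₁₃CoPH F N → Rg F θ → θ.Admissible F N → (ℓ F θ).Signs)
    (hκ : ∀ (F : T4Family) (θ : Stage13HParams F N), θ.Provisos₁₃CoPH F N → Rg F θ → θ.Admissible F N → 0 < (ℓ F θ).κ)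
    (hL : ∀ (F : T4Family) (θ : Stage13HParams F N), θ.Provisos₁₃CoPH F N → Rg F θ → θ.Admissible F N → PolLimitsExistOfRecord₁₃ F N θ.toStage13Params)
    (h9 : ∀ (F : T4Family) (θ : Stage13HParams F N), θ.Provisos₁₃CoPH F N → Rg F θ → θ.Admissible F N →
      WindowedNE9OfRecord₁₃ F N θ.toStage13Params (ℓ F θ).κ (ℓ F θ).moduli)
    (hS : ∀ (F : T4Family) (θ : Stage13HParams F N), θ.Provisos₁₃CoPH F N → Rg F θ → θ.Admissible F N →
      WindowedStepRateOfRecord₁₃ F N θ.toStage13Params (s F θ) (ℓ F θ).κ (ℓ F θ).θ₅ ((ℓ F θ).C₅ * (ℓ F θ).θ₅))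
    (hW : ∀ (F : T4Family) (θ : Stage13HParams F N), θ.Provisos₁₃CoPH F N → Rg F θ → θ.Admissible F N →
      WindowedDecayOfRecord₁₃ F N θ.toStage13Params 0 1 (ℓ F θ).κ) :
    ∀ (F : T4Family) (θ : Stage13HParams F N), θ.Provisos₁₃CoPH F N → Rg F θ → θ.Admissible F N → 0 < θ.toStage13Params.γ →
      ∀ (c : ℕ → ℝ) (cinf : ℝ),
        (∀ k : ℕ, Tendsto (fun t : ℝ => betaOfRecord₁₃ F N θ.toStage13Params k (fun _ : Fin (k + 1) => t)) (𝓝[>] (0 : ℝ)) (𝓝 (c k))) →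
        Tendsto c atTop (𝓝 cinf) →
          Tendsto (fun t : ℝ => betaInf (betaOfRecord₁₃ F N θ.toStage13Params) (fun _ : ℕ => t)) (𝓝[>] (0 : ℝ)) (𝓝 cinf) :=
  fun F θ hP hRg hθ hγ _ _ hc hcinf =>
    tendsto_betaInf_betaOfRecord₁₃_const_of_cornerNumbers F N θ.toStage13Params (ℓ F θ) (hs F θ hP hRg hθ) hγ (hκ F θ hP hRg hθ)
      (kernelNE9OfRecord_guarded_of_rows Rg ℓ hs hL h9 F θ hP hRg hθ)
      (kernelDecayOfRecord₁₃_of_windowed F N θ.toStage13Params 0 1 (ℓ F θ).κ (hL F θ hP hRg hθ) (hW F θ hP hRg hθ))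
      (kernelStepRateOfRecord₁₃_guarded_of_rows Rg ℓ s hL hS F θ hP hRg hθ) hc hcinf

end YMDAG.N18.StationaryKernelOfKernelLetters

end
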